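import Summits.ValiantsHypothesis.ValiantsHypothesis.Theorems.GrenetZeonDualUnipotentThreeHalvesHeavyTopHalfSpeed

/-!
# `GrenetZeon.DualUnipotentThreeHalves` (stmt-ValiantsHypothesis-24318), LINE β `half_speed`, stub K1 — the two LEAVES of the
# induction: KILL (small constituent, `T = 0`, codimension `≤ d²`) and CERTIFY (irreducible constituent, by C⁺)

The chain loop of K1 (`HalfSpeedIrrLaw → HalfSpeedLaw`) ends in two kinds of leaves; both are typed here in the loop's currency
`∃ T ≤ U, HalfSpeed Θ U T ∧ (codimension bound)`:
* `exists_kill_leaf` — any set/space `U` of `ι × ι` matrices is half-speed of every height against `T = ⊥`, at codimension cost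
  `finrank U ≤ (card ι)²` (✓ `halfSpeed_zero`);
* `exists_certify_leaf` — an IRREDUCIBLE nilpotent space is certified by the hypothesis C⁺ = `HalfSpeedIrrLaw` (literal instantiation,
  recorded so the loop can call both leaves by one name shape).
Honest framing: plumbing for a stub of LINE β; nothing here proves `HalfSpeedLaw`, `HalfSpeedIrrLaw`, `HeavyTopLaw`, 24318, S3b or
8062; `VP ≠ VNP` is not moved; no summit statement is proved here.  No definitions, no named facts. [β card K1; val-port-3 g2]
-/

noncomputable section

-- single-conjunct layout: Sub = Summit, duplicated namespace component intended
set_option linter.dupNamespace false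

namespace Summit.ValiantsHypothesis.ValiantsHypothesis.Theorems.GrenetZeon.HalfSpeed

open Matrix

/-- **KILL LEAF.**  Against `T = ⊥` every space is half-speed of every height, and the codimension paid is `finrank U ≤ (card ι)²`.
[β card K1 «kill»; ✓ `halfSpeed_zero`] -/
theorem exists_kill_leaf {ι : Type*} [Fintype ι] [DecidableEq ι] (Θ : ℕ) (U : Submodule ℂ (Matrix ι ι ℂ)) :
    ∃ T : Submodule ℂ (Matrix ι ι ℂ), T ≤ U ∧ HalfSpeed Θ (U : Set (Matrix ι ι ℂ)) T ∧
      Module.finrank ℂ U ≤ Module.finrank ℂ T + Fintype.card ι ^ 2 := by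
  refine ⟨⊥, bot_le, ?_, ?_⟩
  · have h := halfSpeed_zero Θ (U : Set (Matrix ι ι ℂ))
    simpa using h
  · rw [finrank_bot, zero_add]
    calc Module.finrank ℂ U ≤ Module.finrank ℂ (Matrix ι ι ℂ) := Submodule.finrank_le U
      _ = Fintype.card ι ^ 2 := by rw [Module.finrank_matrix, Module.finrank_self, mul_one, sq]

/-- **CERTIFY LEAF.**  An irreducible nilpotent space of `d × d` matrices is certified at every height `1 ≤ Θ ≤ d` by C⁺, with
`Θ · codim ≤ C · d²` (literal instantiation of `HalfSpeedIrrLaw`). [β card K1 «certify»] -/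
theorem exists_certify_leaf (hC : HalfSpeedIrrLaw) :
    ∃ C : ℕ, ∀ (d : ℕ) (U : Submodule ℂ (Matrix (Fin d) (Fin d) ℂ)), (∀ A ∈ U, IsNilpotent A) →
      (∀ V : Submodule ℂ (Fin d → ℂ), (∀ A ∈ U, ∀ x ∈ V, A *ᵥ x ∈ V) → V = ⊥ ∨ V = ⊤) →
      ∀ Θ : ℕ, 1 ≤ Θ → Θ ≤ d →
        ∃ T : Submodule ℂ (Matrix (Fin d) (Fin d) ℂ), T ≤ U ∧
          Θ * (Module.finrank ℂ U - Module.finrank ℂ T) ≤ C * d ^ 2 ∧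
          HalfSpeed Θ (U : Set (Matrix (Fin d) (Fin d) ℂ)) (T : Set (Matrix (Fin d) (Fin d) ℂ)) :=
  hC

end Summit.ValiantsHypothesis.ValiantsHypothesis.Theorems.GrenetZeon.HalfSpeed

end
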